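import Summits.NavierStokesRegularity.NavierStokesRegularity.Theorems.FrequencyRigidity.Negative.FrequencyStructure
import Summits.NavierStokesRegularity.NavierStokesRegularity.Theorems.FrequencyRigidity.Negative.SmallLocalTypeI
import Literature.Analysis.FluidPDE.AdaptedBackwardKernel
import Literature.Analysis.FluidPDE.SelfSimilar
import Literature.Analysis.FluidPDE.TaoEnstrophyLocalisation
import HarnessLib.Audit

/-!
# `FrequencyRigidity` (crux `stmt-NavierStokesRegularity-2955`), line `two-ended-pinning`: small-model and
# mutation facts about its stub set — negative-side support (refuter, drefute)

Sorry-free small-model / mutation facts about the v2 stub set of the crux work-file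
`Cruxes/FrequencyRigidity/Lines/two-ended-pinning.lean` (its vocabulary `ScaleInvariantBounds`,
`firstVariationDensity`, `IsFlatInhabitant` and the signature of `stub_flatEnstrophyLiouville` are copied
verbatim — the skeleton is a work-file and is not importable).  No `¬`-theorem of a Theses decl is
claimed; nothing here asserts a route statement positively.

* `scaleInvariantBounds_zero`, `hyps_2b_satisfiable` — the hypotheses of Stubs 1a/2b/2c are satisfiable
  (zero flow + backward heat kernel): the stubs are not vacuous.
* `kernelPairing_const` — Stub 2b's conclusion holds at `φ ≡ c` for EVERY adapted kernel (consistency of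
  the formula with unit mass: `d/dt ∫ c K = 0 = ∫ (0 + 0 − ν0) K`).
* `stub_unitTimeDerivBounds_false_without_typeI` — dropping the Type-I hypothesis from Stub 1a makes it
  FALSE (fast rigid rotations `Ω e₃ × x`: classical NS, `‖Du(−1)‖ = |Ω|‖rot‖ → ∞`): any proof of 1a uses
  the global Type-I bound (cf. Disproof (B)).
* `stub_flatEnstrophyLiouville_false_without_posA` / `_false_without_flatLaw` — dropping clause (vii)
  `0 < A` or clause (viii) (the flat law) from `IsFlatInhabitant` makes Stub 3 FALSE (zero flow, heat
  kernel): both are load-bearing (cf. Disproof (A), `Negative/Clauses.lean`).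

## References

* G. Koch, N. Nadirashvili, G. Seregin, V. Šverák, *Liouville theorems for the Navier–Stokes equations and
  applications*, Acta Math. 203 (2009) 83–105, §4. [KochNadirashviliSereginSverak2009]
* C.-C. Poon, *Unique continuation for parabolic equations*, Comm. PDE 21 (1996) 521–539. [Poon1996]
-/

noncomputable section

set_option linter.dupNamespace false

namespace Summit.NavierStokesRegularity.NavierStokesRegularity.Theorems.FrequencyRigidity.Negative.TwoEndedPinning

open Literature.Analysis.FluidPDE MeasureTheory Set Filter Topology Function
open scoped RealInnerProductSpace Laplacian ContDiff

/-! ### Verbatim vocabulary of the line -/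

/-- Verbatim copy of the skeleton's `ScaleInvariantBounds`. -/
def ScaleInvariantBounds (C' : ℕ → ℝ) (v : ℝ → E3 → E3) : Prop :=
  ∀ k : ℕ, 1 ≤ k → ∀ t < 0, ∀ x, ‖iteratedFDeriv ℝ k (v t) x‖ ≤ C' k * (-t) ^ (-((k : ℝ) + 1) / 2)

/-- Verbatim copy of the skeleton's `firstVariationDensity`. -/
def firstVariationDensity (ν : ℝ) (v : ℝ → E3 → E3) (t : ℝ) (x : E3) : ℝ :=
  2 * (⟪curl (v t) x, fderiv ℝ (v t) x (curl (v t) x)⟫ - ν * frobeniusNormSq (fderiv ℝ (curl (v t)) x))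

/-- Verbatim copy of the skeleton's `IsFlatInhabitant`. -/
def IsFlatInhabitant (ν C A : ℝ) (C' : ℕ → ℝ) (v : ℝ → E3 → E3) (q : ℝ → E3 → ℝ)
    (K : ℝ → E3 → ℝ) : Prop :=
  0 < ν ∧ IsClassicalNSSolutionOn (Iio 0) ν 0 v q ∧ HasTypeITimeDecay C v ∧
    ScaleInvariantBounds C' v ∧ IsAdaptedBackwardKernel ν v (Iio 0) 0 0 K ∧
    IsGaussianComparable K (Iio 0) 0 0 ∧ 0 < A ∧
    (∀ t < 0, adaptedEnstrophy v K t = A * (-t) ^ (-(2 : ℝ))) ∧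
    (∀ t < 0, HasDerivAt (adaptedEnstrophy v K) (∫ x, firstVariationDensity ν v t x * K t x) t)

/-- Verbatim copy of `Sig.stub_flatEnstrophyLiouville`. -/
def Sig.stub_flatEnstrophyLiouville : Prop :=
  ∀ (ν C A : ℝ) (C' : ℕ → ℝ) (v : ℝ → E3 → E3) (q : ℝ → E3 → ℝ) (K : ℝ → E3 → ℝ),
    ¬ IsFlatInhabitant ν C A C' v q K

/-! ### The zero flow -/

/-- `curl 0 = 0` as functions. -/
theorem curl_zero_fun : curl (fun _ : E3 => (0 : E3)) = fun _ => 0 :=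
  funext fun x => curl_const 0 x

/-- The zero flow has all scale-invariant bounds with constants `0`. -/
theorem scaleInvariantBounds_zero : ScaleInvariantBounds (fun _ => 0) (fun _ _ => (0 : E3)) := by
  intro k _ t _ x
  show ‖iteratedFDeriv ℝ k (fun _ : E3 => (0 : E3)) x‖ ≤ 0 * (-t) ^ (-((k : ℝ) + 1) / 2)
  rw [iteratedFDeriv_fun_zero]
  simp

/-- The zero flow is time-Type-I with constant `0`. -/
theorem hasTypeITimeDecay_zero : HasTypeITimeDecay 0 (fun (_ : ℝ) (_ : E3) => (0 : E3)) := by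
  intro t _ x; simp

/-- The adapted enstrophy of the zero flow vanishes identically. -/
theorem adaptedEnstrophy_zero (K : ℝ → E3 → ℝ) :
    adaptedEnstrophy (fun _ _ => (0 : E3)) K = fun _ => 0 := by
  funext t
  rw [adaptedEnstrophy_apply]
  simp

/-- The first-variation density of the zero flow vanishes identically. -/
theorem firstVariationDensity_zero (ν t : ℝ) (x : E3) :
    firstVariationDensity ν (fun _ _ => (0 : E3)) t x = 0 := by
  simp only [firstVariationDensity, curl_zero_fun, inner_zero_left]
  simp [frobeniusNormSq]

/-- The backward heat kernel is adapted to the zero drift (tree lemma, drift written as a lambda). -/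
theorem isAdaptedBackwardKernel_zero {ν : ℝ} (hν : 0 < ν) :
    IsAdaptedBackwardKernel ν (fun (_ : ℝ) (_ : E3) => (0 : E3)) (Iio 0) 0 0
      (backwardHeatKernel ν 0 (0 : E3)) :=
  isAdaptedBackwardKernel_backwardHeatKernel hν 0 0

/-- The Laplacian of a constant scalar field vanishes. -/
theorem laplacian_const_fun (c : ℝ) (x : E3) : (Δ (fun _ : E3 => c)) x = 0 := by
  rw [InnerProductSpace.laplacian_eq_iteratedFDeriv_stdOrthonormalBasis,
    iteratedFDeriv_const_of_ne (by norm_num)]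
  simp

/-! ### Non-vacuity of the hypotheses of Stubs 1a / 2b / 2c -/

/-- The hypotheses of Stub 1a (and of 2c, planner's Stub 2) are satisfiable: zero flow. -/
theorem hyps_1a_satisfiable :
    ∃ (u : ℝ → E3 → E3) (p : ℝ → E3 → ℝ),
      IsClassicalNSSolutionOn (Iio 0) 1 0 u p ∧ HasTypeITimeDecay 0 u ∧
        ScaleInvariantBounds (fun _ => 0) u :=
  ⟨fun _ _ => 0, fun _ _ => 0, isClassicalNSSolutionOn_zero _ _, hasTypeITimeDecay_zero,
    scaleInvariantBounds_zero⟩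

/-- The hypotheses of Stub 2b are satisfiable (zero drift, heat kernel, `φ ≡ 1`). -/
theorem hyps_2b_satisfiable :
    ∃ (ν C : ℝ) (v : ℝ → E3 → E3) (K φ : ℝ → E3 → ℝ),
      IsSmoothSpaceTimeOn (Iio 0) v ∧ (∀ t ∈ Iio (0 : ℝ), VectorCalculus.IsDivFree (v t)) ∧
      HasTypeITimeDecay C v ∧ IsAdaptedBackwardKernel ν v (Iio 0) 0 0 K ∧
      IsGaussianComparable K (Iio 0) 0 0 ∧ IsSmoothSpaceTimeOn (Iio 0) φ ∧
      (∀ a b : ℝ, a < b → b < 0 → ∃ B : ℝ, ∀ t ∈ Icc a b, ∀ x : E3,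
        |φ t x| ≤ B ∧ ‖fderiv ℝ (φ t) x‖ ≤ B ∧ |Δ (φ t) x| ≤ B ∧ |deriv (fun s => φ s x) t| ≤ B) := by
  refine ⟨1, 0, fun _ _ => 0, backwardHeatKernel 1 0 (0 : E3), fun _ _ => 1,
    (isClassicalNSSolutionOn_zero (Iio 0) 1).smooth_velocity,
    (isClassicalNSSolutionOn_zero (Iio 0) 1).divFree, hasTypeITimeDecay_zero,
    isAdaptedBackwardKernel_zero one_pos, isGaussianComparable_backwardHeatKernel one_pos 0 0,
    contDiffOn_const, fun a b _ _ => ⟨1, fun t _ x => ?_⟩⟩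
  have hf : fderiv ℝ (fun _ : E3 => (1 : ℝ)) x = 0 := (hasFDerivAt_const (1 : ℝ) x).fderiv
  simp [laplacian_const_fun, hf]

/-! ### Stub 2b at `φ ≡ c`: consistency with unit mass -/

/-- **Stub 2b's conclusion at a constant test field**, for every adapted kernel on `(−∞,0)`:
`s ↦ ∫ c K(s) = c` near `t`, so its derivative is `0`, and the predicted value
`∫ (∂ₜc + Dc·v − νΔc) K = 0` agrees. -/
theorem kernelPairing_const {ν : ℝ} {v : ℝ → E3 → E3} {K : ℝ → E3 → ℝ}
    (hK : IsAdaptedBackwardKernel ν v (Iio 0) 0 0 K) (c : ℝ) {t : ℝ} (ht : t < 0) :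
    HasDerivAt (fun s => ∫ x, (fun (_ : ℝ) (_ : E3) => c) s x * K s x)
      (∫ x, (deriv (fun s => (fun (_ : ℝ) (_ : E3) => c) s x) t
        + fderiv ℝ ((fun (_ : ℝ) (_ : E3) => c) t) x (v t x)
        - ν * (Δ ((fun (_ : ℝ) (_ : E3) => c) t)) x) * K t x) t := by
  have hf : ∀ x : E3, fderiv ℝ (fun _ : E3 => c) x = 0 := fun x => (hasFDerivAt_const c x).fderiv
  have hint : (∫ x, (deriv (fun s => (fun (_ : ℝ) (_ : E3) => c) s x) t
        + fderiv ℝ ((fun (_ : ℝ) (_ : E3) => c) t) x (v t x)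
        - ν * (Δ ((fun (_ : ℝ) (_ : E3) => c) t)) x) * K t x) = 0 := by
    simp [hf, laplacian_const_fun]
  rw [hint]
  show HasDerivAt (fun s => ∫ x, c * K s x) 0 t
  have hev : (fun s => ∫ x, c * K s x) =ᶠ[𝓝 t] fun _ => c := by
    filter_upwards [Iio_mem_nhds ht] with s hs
    rw [integral_const_mul, hK.integral_eq_one s hs, mul_one]
  exact (hasDerivAt_const t c).congr_of_eventuallyEq hev

/-! ### Stub 1a without the Type-I hypothesis is FALSE -/

/-- Stub 1a with `HasTypeITimeDecay C u` DROPPED (the `∀ C` prefix then collapses). -/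
def Sig.stub_unitTimeDerivBoundsWithoutTypeI : Prop :=
  ∃ C' : ℕ → ℝ,
    ∀ (u : ℝ → EuclideanSpace ℝ (Fin 3) → EuclideanSpace ℝ (Fin 3))
      (p : ℝ → EuclideanSpace ℝ (Fin 3) → ℝ),
      Literature.Analysis.FluidPDE.IsClassicalNSSolutionOn (Set.Iio 0) 1 0 u p →
      ∀ k : ℕ, 1 ≤ k → ∀ x : EuclideanSpace ℝ (Fin 3), ‖iteratedFDeriv ℝ k (u (-1)) x‖ ≤ C' k

/-- `‖rot‖ ≥ 1` (`rot e₀ = e₁`). -/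
theorem one_le_norm_rot : 1 ≤ ‖rot‖ := by
  have h1 : ‖rot (EuclideanSpace.single 0 1)‖ = 1 := by
    have : rot (EuclideanSpace.single 0 1) = EuclideanSpace.single 1 1 := by
      ext i
      fin_cases i <;> simp
    rw [this, PiLp.norm_single, norm_one]
  have h2 := rot.unit_le_opNorm (EuclideanSpace.single (0 : Fin 3) (1 : ℝ))
    (by rw [PiLp.norm_single, norm_one])
  linarith

/-- **Any proof of Stub 1a must use the Type-I bound**: without it the uniform gradient bound at
`t = −1` fails on the fast rigid rotations `u = Ω e₃ × x` (classical steady NS flows,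
`isClassicalNSSolutionOn_skew`), whose gradient `Ω rot` has norm `|Ω| ‖rot‖ ≥ |Ω|`. -/
theorem stub_unitTimeDerivBounds_false_without_typeI : ¬ Sig.stub_unitTimeDerivBoundsWithoutTypeI := by
  rintro ⟨C', hC'⟩
  set Ω : ℝ := |C' 1| + 1 with hΩ
  have hNS := isClassicalNSSolutionOn_skew (Ω • rot) (smul_rot_skew Ω) (Iio 0) 1
  have h := hC' (fun _ x => (Ω • rot) x) (fun _ x => 2⁻¹ * ‖(Ω • rot) x‖ ^ 2) hNS 1
    le_rfl 0
  rw [norm_iteratedFDeriv_one] at h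
  have hf : fderiv ℝ (fun x : E3 => (Ω • rot) x) 0 = Ω • rot :=
    (Ω • rot).fderiv
  rw [hf, norm_smul, Real.norm_eq_abs] at h
  have hΩpos : 0 < Ω := by positivity
  have h1 : |Ω| * 1 ≤ |Ω| * ‖rot‖ := mul_le_mul_of_nonneg_left one_le_norm_rot (abs_nonneg _)
  rw [abs_of_pos hΩpos] at h h1
  have : C' 1 ≤ |C' 1| := le_abs_self _
  linarith

/-! ### Stub 3 without `0 < A`, or without the flat law, is FALSE -/

/-- `IsFlatInhabitant` with clause (vii) `0 < A` DROPPED. -/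
def IsFlatInhabitantWithoutPosA (ν C A : ℝ) (C' : ℕ → ℝ) (v : ℝ → E3 → E3) (q : ℝ → E3 → ℝ)
    (K : ℝ → E3 → ℝ) : Prop :=
  0 < ν ∧ IsClassicalNSSolutionOn (Iio 0) ν 0 v q ∧ HasTypeITimeDecay C v ∧
    ScaleInvariantBounds C' v ∧ IsAdaptedBackwardKernel ν v (Iio 0) 0 0 K ∧
    IsGaussianComparable K (Iio 0) 0 0 ∧
    (∀ t < 0, adaptedEnstrophy v K t = A * (-t) ^ (-(2 : ℝ))) ∧
    (∀ t < 0, HasDerivAt (adaptedEnstrophy v K) (∫ x, firstVariationDensity ν v t x * K t x) t)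

/-- `IsFlatInhabitant` with clause (viii) (the flat law `H = A(−t)^{−2}`) DROPPED. -/
def IsFlatInhabitantWithoutFlatLaw (ν C A : ℝ) (C' : ℕ → ℝ) (v : ℝ → E3 → E3) (q : ℝ → E3 → ℝ)
    (K : ℝ → E3 → ℝ) : Prop :=
  0 < ν ∧ IsClassicalNSSolutionOn (Iio 0) ν 0 v q ∧ HasTypeITimeDecay C v ∧
    ScaleInvariantBounds C' v ∧ IsAdaptedBackwardKernel ν v (Iio 0) 0 0 K ∧
    IsGaussianComparable K (Iio 0) 0 0 ∧ 0 < A ∧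
    (∀ t < 0, HasDerivAt (adaptedEnstrophy v K) (∫ x, firstVariationDensity ν v t x * K t x) t)

/-- The first-variation clause (ix) holds for the zero flow against any kernel (`0 = ∫ 0·K`). -/
theorem firstVariation_zero (ν : ℝ) (K : ℝ → E3 → ℝ) (t : ℝ) :
    HasDerivAt (adaptedEnstrophy (fun _ _ => (0 : E3)) K)
      (∫ x, firstVariationDensity ν (fun _ _ => (0 : E3)) t x * K t x) t := by
  rw [adaptedEnstrophy_zero]
  simp only [firstVariationDensity_zero, zero_mul, integral_zero]
  exact hasDerivAt_const t 0

/-- **Clause (vii) `0 < A` is load-bearing in Stub 3**: the zero flow with the heat kernel and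
`A = 0` is a flat inhabitant without it. -/
theorem stub_flatEnstrophyLiouville_false_without_posA :
    ¬ ∀ (ν C A : ℝ) (C' : ℕ → ℝ) (v : ℝ → E3 → E3) (q : ℝ → E3 → ℝ) (K : ℝ → E3 → ℝ),
      ¬ IsFlatInhabitantWithoutPosA ν C A C' v q K := by
  intro h
  refine h 1 0 0 (fun _ => 0) (fun _ _ => 0) (fun _ _ => 0) (backwardHeatKernel 1 0 (0 : E3))
    ⟨one_pos, isClassicalNSSolutionOn_zero _ _, hasTypeITimeDecay_zero,
      scaleInvariantBounds_zero, isAdaptedBackwardKernel_zero one_pos,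
      isGaussianComparable_backwardHeatKernel one_pos 0 0, fun t _ => ?_, fun t _ => firstVariation_zero 1 _ t⟩
  rw [adaptedEnstrophy_zero]; simp

/-- **Clause (viii) (the flat law) is load-bearing in Stub 3**: the zero flow with the heat kernel
and `A = 1` is a flat inhabitant without it. -/
theorem stub_flatEnstrophyLiouville_false_without_flatLaw :
    ¬ ∀ (ν C A : ℝ) (C' : ℕ → ℝ) (v : ℝ → E3 → E3) (q : ℝ → E3 → ℝ) (K : ℝ → E3 → ℝ),
      ¬ IsFlatInhabitantWithoutFlatLaw ν C A C' v q K := by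
  intro h
  exact h 1 0 1 (fun _ => 0) (fun _ _ => 0) (fun _ _ => 0) (backwardHeatKernel 1 0 (0 : E3))
    ⟨one_pos, isClassicalNSSolutionOn_zero _ _, hasTypeITimeDecay_zero,
      scaleInvariantBounds_zero, isAdaptedBackwardKernel_zero one_pos,
      isGaussianComparable_backwardHeatKernel one_pos 0 0, one_pos, fun t _ => firstVariation_zero 1 _ t⟩

/-- Sanity: the zero flow is NOT a flat inhabitant (it fails exactly (vii)/(viii): `H ≡ 0`). -/
theorem not_isFlatInhabitant_zero (ν C A : ℝ) (C' : ℕ → ℝ) (q : ℝ → E3 → ℝ) (K : ℝ → E3 → ℝ) :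
    ¬ IsFlatInhabitant ν C A C' (fun _ _ => 0) q K := by
  rintro ⟨-, -, -, -, -, -, hA, hlaw, -⟩
  have h := hlaw (-1) (by norm_num)
  rw [adaptedEnstrophy_zero] at h
  have : (0 : ℝ) < A * (-(-1 : ℝ)) ^ (-(2 : ℝ)) := by
    have : (0 : ℝ) < (-(-1 : ℝ)) ^ (-(2 : ℝ)) := Real.rpow_pos_of_pos (by norm_num) _
    positivity
  linarith

end Summit.NavierStokesRegularity.NavierStokesRegularity.Theorems.FrequencyRigidity.Negative.TwoEndedPinning

end
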